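import Summits.QuantumFields.YangMills.Theorems.BalabanUVNodesN07ChartD2EqC2
import HarnessLib

/-!
# BalabanUVNodes ∕ N07 — [15] (56) ITSELF, «D(A′) = Σ_{n=2}^∞ D^{(n)}(A′)», AS A CONVERGENT SERIES AT NODE 00's RECORD, EVERY HOMOGENEOUS TERM NAMED, IDENTIFIED AND SIZED — for
# the TRUE multi-level chart `D(·)` of (47)–(49)

Cell `pub-ymgap`, width seat `pub-ymgap-dag-n07-w2` generation 6 (HUMAN RULING D-0149; DAG node N07 = [15] = [Balaban1985Variational]; W-SEAT START LIST §n07 item 2 = S2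
«[15] Sect. C (47)–(49), Prop. 3 at objects» — the display (56)).  `--kind proof --supports stmt-QuantumFields-27364 --as helper` (K1⁹ face per KEY MAP v2; count-neutral).
CONSUMED BY NAME, nothing modified: this seat's `N07ChartD2EqC2.exists_chartD2_eq_C2_T4` (ONE `(H, Dfun)` at the record with everything of generations 3–6: (46), `C^ω`, holomorphic
`fderiv`, `fderiv ℂ Dfun 0 = 0`, per-point (55)∕(49)∕(48)∕(73), the 𝔇^{(1)}∕𝔇₂ bounds in both definitions, `D^{(2)} = C^{(2)}`, `D₃` cubic), dag k0-s1-w2's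
`K0Stub1ChartDAnalytic.isOpen_weightedBall`; Mathlib's `Complex.hasSum_taylorSeries_on_ball` (Taylor series of a holomorphic function on a disc), `Complex.norm_iteratedDeriv_le_of_forall_mem_sphere_norm_le`
(Cauchy's estimate), `HasFPowerSeriesOnBall.compContinuousLinearMap` ∕ `.factorial_smul` (the slice's Taylor coefficients are the diagonals of the differentials), `ContDiffAt.analyticAt`.
The MODEL, cited BY NAME and not imported: lit-balaban p06's `B11Eq56SeriesConcrete` (`DtN`, `DtN_zero∕one∕two`, `norm_DtN_le`, `DtN_smul`, `hasSum_DtN`, `norm_Dt_sub_partialSum_le`) =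
the same statements for the CONCRETE one-scale `ℤᵈ` fixed point `D̃`; its private chain-rule device `iteratedDeriv_comp_mul_eventually` is re-derived here (§1).

THE PRINT (p. 286 [PDF 10], text layer `paper:balaban1985-cmp102-variational-background` p. 10 re-read by this seat): «This implies that a power series expansion of D(A′) begins with
second order terms. We can find this expression from Eq. (49) and the expansion (136) [4] of the function C_j: C_j(LʲηA′ − LʲηHD(A′)) = Σ_{n=2}^∞ C_j^{(n)}(LʲηA′ − LʲηH Σ_{m=2}^∞
D^{(m)}(A′)) = Σ_{n=2}^∞ D^{(n)}(A′), (56) where C_j^{(n)}, D^{(n)} are homogeneous polynomials of nth order.»; after (54): «… it is an analytic function of A′.»  The radius and the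
sizes of the terms are printed nowhere (the print asserts the expansion); they are what Cauchy's estimate gives from analyticity on the chart ball and (55) — p06's reading for `D̃`.

THE READING (tree vocabulary, NO new definition).  Print's `D^{(n)}(A′)` IS the `n`-th Taylor term `(n!)⁻¹ • iteratedDeriv n (τ ↦ Dfun(τ•A′)) 0` of the complex slice, EQUAL to the
diagonal `(n!)⁻¹DⁿDfun(0)(A′, …, A′)` of the `n`-th differential (`C^ω` at `0`); the left member of (56) is `Dfun A′` by (49); orders `0, 1` vanish ((55)); order two is `½Q₂(A′)(A′) =
C^{(2)}(A′)` (FILE 1's (56₁)).  For weighted size `σ < ε` the slice is holomorphic on `|τ| < ε∕σ > 1` with `‖Dfun(τ•A′)‖ ≤ 4C₂σ²|τ|²`, so the series converges at `τ = 1`, Cauchy gives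
`‖D^{(n)}(A′)‖ ≤ 4C₂ε²(σ∕ε)ⁿ`, and the tail after `N` terms is `≤ 4C₂ε²(σ∕ε)ᴺ(1 − σ∕ε)⁻¹`.

WHAT IS PROVED (sorry-free; no definition; axioms standard).  §1 (abstract: `Φ` holomorphic on an open `U` ⊇ the segment `{τ•A : |τ| < r}`, `Y` complete) `differentiableOn_slice` ·
`iteratedDeriv_comp_mul_eventually` · ★★ `hasSum_taylor_slice` ((56) along the slice) · ★★ `taylor_slice_smul` (homogeneity `sⁿ`) · ★★ `norm_taylor_slice_le` (Cauchy under (55):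
`‖(n!)⁻¹f⁽ⁿ⁾(0)‖ ≤ Kr²∕rⁿ`) · ★★ `iteratedDeriv_slice_eq_iteratedFDeriv` (`f⁽ⁿ⁾(0) = DⁿΦ(0)(A, …, A)`) · `norm_sub_partialSum_le_of_geometric` (tail `MqᴺN⁰(1 − q)⁻¹ = Mqᴺ(1−q)⁻¹`).
§2 ★★★★ `exists_chartD56_series_T4` — `N07ChartD2EqC2.exists_chartD2_eq_C2_T4` RE-EXPORTED VERBATIM ∧ for the SAME `Dfun`: (56) as `HasSum`, the diagonal identification, orders `0`∕`1`
vanish, order `2` = `½Q₂(A′)(A′)`, homogeneity, Cauchy `4C₂ε²(σ∕ε)ⁿ` per index, tail `4C₂ε²(σ∕ε)ᴺ(1 − σ∕ε)⁻¹` per index.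

HONEST FRAMING: count-neutral helper; one-variable Taylor ∕ Cauchy bookkeeping (Mathlib) on this seat's record package — NO new estimate of [15]; radius and term sizes are Cauchy's
from (55) (printed nowhere); the printed `D^{(3)}` formula ∕ the recursion beyond order two, (58), the ∇-row of (46), (79)–(80), (85)–(86) and [15] Sects. D–F NOT here; stub 1 ∕
K0⁷ ∕ K1⁹ NOT closed; N07 NOT discharged; counts unmoved; one finite T⁴ programme at fixed ε — NOT continuum ∕ ℝ⁴ ∕ OS ∕ mass gap ∕ Clay: the Yang–Mills mass gap is NOT proved by
any of this; R4 closes the conditional rung `BalabanLadder.UV` only.  No `sorry`, no `def`, no `instance`, no `notation`.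

References: [15] T. Bałaban, CMP 102 (1985) 277–309 [Balaban1985Variational] ((47)–(49) p.285, (54)–(56) p.286, Prop. 3 + remark p.289, (78)∕(80) p.290); [4] = [B7] CMP 98 (1985)
17–51 [Balaban1985Averaging] ((136)–(137) p.39).
-/

noncomputable section

open scoped BigOperators Matrix.Norms.L2Operator ContDiff Topology Nat
open NormedSpace Metric Set Filter Asymptotics

namespace Summit.QuantumFields.YangMills.BalabanUVNodes.N07ChartD56Series

open Literature.MathematicalPhysics.QuantumFieldTheory.Balaban1983to89
open Literature.MathematicalPhysics.QuantumFieldTheory.Balaban1983to89.T4Continuum (T4Family)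
open B6SectADomainsV1 (Domains)
open B6SectAOperatorsV1 (BondIdx)
open Summit.QuantumFields.YangMills.Theorems.FlatCubeOpsText (Adm22 distBI)
open Summit.QuantumFields.YangMills.Theorems.K0FlatCubeOpsTextP (IsLevWeight levWeight_nonneg)
open Summit.QuantumFields.YangMills.Theorems.Prop8Chart (chartLog)
open Summit.QuantumFields.YangMills.Theorems.K0Stub1ChartDAnalytic (isOpen_weightedBall)
open Summit.QuantumFields.YangMills.BalabanUVNodes.N07ChartD2EqC2 (exists_chartD2_eq_C2_T4)

/-! ## §1 The Taylor series of a slice: convergence, homogeneity, Cauchy bounds, identification with the differentials (abstract) -/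

section Slice

variable {X Y : Type*} [NormedAddCommGroup X] [NormedSpace ℂ X] [NormedAddCommGroup Y] [NormedSpace ℂ Y]

/-- The slice `τ ↦ Φ(τ•A)` is holomorphic on every disc whose segment lies in the holomorphy domain `U` of `Φ`. [cite: Balaban1985Variational, (54)-(56) p.286; Balaban1985Averaging, (137) p.39] -/
theorem differentiableOn_slice {Φ : X → Y} {U : Set X} (hΦ : DifferentiableOn ℂ Φ U) (A : X) {r : ℝ}
    (hmaps : ∀ τ : ℂ, ‖τ‖ < r → τ • A ∈ U) :
    DifferentiableOn ℂ (fun τ : ℂ => Φ (τ • A)) (ball (0 : ℂ) r) := by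
  refine hΦ.comp (f := fun τ : ℂ => τ • A) (differentiableOn_id.smul_const A) ?_
  intro τ hτ
  exact hmaps τ (mem_ball_zero_iff.mp hτ)

variable [CompleteSpace Y]

/-- For `ψ` analytic near `0`, `s ∈ ℂ`: near `t = 0`, `(dⁿ∕dtⁿ)[ψ(s·t)] = sⁿ·ψ⁽ⁿ⁾(s·t)` (p06's private device of `B11Eq56SeriesConcrete`, re-derived). [folklore] -/
theorem iteratedDeriv_comp_mul_eventually {ψ : ℂ → Y} (hψ : ∀ᶠ u in 𝓝 (0 : ℂ), AnalyticAt ℂ ψ u) (s : ℂ) (n : ℕ) :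
    ∀ᶠ t in 𝓝 (0 : ℂ), iteratedDeriv n (fun u : ℂ => ψ (s * u)) t = s ^ n • iteratedDeriv n ψ (s * t) := by
  -- adapted from lean/Literature/…/Balaban1983to89/B11Eq56SeriesConcrete.lean (p06, private `iteratedDeriv_comp_mul_eventually`)
  have hline : Tendsto (fun t : ℂ => s * t) (𝓝 0) (𝓝 0) := by simpa using (continuous_const_mul s).tendsto 0
  have hev : ∀ᶠ t : ℂ in 𝓝 0, AnalyticAt ℂ ψ (s * t) := hline.eventually hψ
  induction n with
  | zero => exact Eventually.of_forall fun t => by simp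
  | succ n ih =>
    filter_upwards [ih.eventually_nhds, hev] with t ht han
    rw [iteratedDeriv_succ, Filter.EventuallyEq.deriv_eq ht]
    have hψn : AnalyticAt ℂ (iteratedDeriv n ψ) (s * t) := by
      rw [iteratedDeriv_eq_iterate]; exact han.iterated_deriv n
    have h1 : HasDerivAt (fun u : ℂ => s * u) s t := by simpa using (hasDerivAt_id t).const_mul s
    have h2 : HasDerivAt (iteratedDeriv n ψ) (iteratedDeriv (n + 1) ψ (s * t)) (s * t) := by
      rw [iteratedDeriv_succ]; exact hψn.differentiableAt.hasDerivAt
    have h3 := (h2.scomp t h1).const_smul (s ^ n)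
    rw [show deriv (fun u : ℂ => s ^ n • iteratedDeriv n ψ (s * u)) t = s ^ n • s • iteratedDeriv (n + 1) ψ (s * t)
      from h3.deriv, smul_smul, pow_succ]

/-- ★★ **(56) ALONG THE SLICE, AS A CONVERGENT TAYLOR SERIES**: `Σ_{n≥0} τⁿ•(n!)⁻¹f⁽ⁿ⁾(0) = Φ(τ•A)` for `|τ| < r` (`Complex.hasSum_taylorSeries_on_ball`). [cite: Balaban1985Variational, (56) p.286] -/
theorem hasSum_taylor_slice {Φ : X → Y} {U : Set X} (hΦ : DifferentiableOn ℂ Φ U) (A : X) {r : ℝ}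
    (hmaps : ∀ τ : ℂ, ‖τ‖ < r → τ • A ∈ U) {τ : ℂ} (hτ : ‖τ‖ < r) :
    HasSum (fun n : ℕ => τ ^ n • ((n ! : ℂ)⁻¹ • iteratedDeriv n (fun s : ℂ => Φ (s • A)) 0)) (Φ (τ • A)) := by
  have h := Complex.hasSum_taylorSeries_on_ball (differentiableOn_slice hΦ A hmaps) (mem_ball_zero_iff.mpr hτ)
  simp only [sub_zero] at h
  refine h.congr_fun fun n => ?_
  rw [smul_comm]

/-- ★★ **«HOMOGENEOUS POLYNOMIALS OF nTH ORDER»**: the `n`-th Taylor term of the slice through `s•A` is `sⁿ` times that through `A` (`U` open ∋ `0`, ANY `A`, `s`, `n`; the slice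
through `s•A` is `t ↦ f(st)`). [cite: Balaban1985Variational, (56) p.286] -/
theorem taylor_slice_smul {Φ : X → Y} {U : Set X} (hU : IsOpen U) (h0 : (0 : X) ∈ U) (hΦ : DifferentiableOn ℂ Φ U)
    (A : X) (s : ℂ) (n : ℕ) :
    iteratedDeriv n (fun τ : ℂ => Φ (τ • (s • A))) 0 = s ^ n • iteratedDeriv n (fun τ : ℂ => Φ (τ • A)) 0 := by
  -- the slice through `A` is analytic near `0`
  have hc : Continuous fun τ : ℂ => τ • A := continuous_id.smul continuous_const
  have hpre : (fun τ : ℂ => τ • A) ⁻¹' U ∈ 𝓝 (0 : ℂ) := hc.continuousAt.preimage_mem_nhds (by simpa using hU.mem_nhds h0)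
  have hψ : ∀ᶠ u in 𝓝 (0 : ℂ), AnalyticAt ℂ (fun t : ℂ => Φ (t • A)) u := by
    have hO : IsOpen ((fun τ : ℂ => τ • A) ⁻¹' U) := hU.preimage hc
    filter_upwards [hpre] with u hu
    have hd : DifferentiableOn ℂ (fun t : ℂ => Φ (t • A)) ((fun τ : ℂ => τ • A) ⁻¹' U) :=
      hΦ.comp (differentiableOn_id.smul_const A) fun x hx => hx
    exact hd.analyticAt (hO.mem_nhds hu)
  have h := (iteratedDeriv_comp_mul_eventually hψ s n).self_of_nhds
  rw [mul_zero] at h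
  have hfun : (fun τ : ℂ => Φ (τ • (s • A))) = fun τ : ℂ => (fun u : ℂ => Φ (u • A)) (s * τ) := by
    funext τ; simp only [smul_smul, mul_comm τ s]
  rw [hfun, h]

/-- ★★ **CAUCHY's ESTIMATE UNDER (55)**: `‖Φ(τ•A)‖ ≤ K|τ|²` on `|τ| < r` (`r > 0`) ⇒ every Taylor term of the slice obeys `‖(n!)⁻¹f⁽ⁿ⁾(0)‖ ≤ K·r²∕rⁿ` — Cauchy on each circle
`|τ| = R < r` (`Complex.norm_iteratedDeriv_le_of_forall_mem_sphere_norm_le`), then `R ↑ r`; printed nowhere (p06's located reading). [cite: Balaban1985Variational, (55)-(56) p.286] -/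
theorem norm_taylor_slice_le {Φ : X → Y} {U : Set X} (hΦ : DifferentiableOn ℂ Φ U) (A : X) {r K : ℝ} (hr : 0 < r)
    (hmaps : ∀ τ : ℂ, ‖τ‖ < r → τ • A ∈ U) (hKb : ∀ τ : ℂ, ‖τ‖ < r → ‖Φ (τ • A)‖ ≤ K * ‖τ‖ ^ 2) (n : ℕ) :
    ‖(n ! : ℂ)⁻¹ • iteratedDeriv n (fun s : ℂ => Φ (s • A)) 0‖ ≤ K * r ^ 2 / r ^ n := by
  set f : ℂ → Y := fun s => Φ (s • A) with hf
  have hfd : DifferentiableOn ℂ f (ball (0 : ℂ) r) := differentiableOn_slice hΦ A hmaps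
  -- on every smaller circle
  have hR : ∀ R : ℝ, 0 < R → R < r → ‖(n ! : ℂ)⁻¹ • iteratedDeriv n f 0‖ ≤ K * R ^ 2 / R ^ n := by
    intro R hR0 hRr
    have hdc : DiffContOnCl ℂ f (ball (0 : ℂ) R) := by
      refine DifferentiableOn.diffContOnCl ?_
      rw [closure_ball (0 : ℂ) hR0.ne']
      exact hfd.mono (closedBall_subset_ball hRr)
    have hsph : ∀ z ∈ sphere (0 : ℂ) R, ‖f z‖ ≤ K * R ^ 2 := by
      intro z hz
      have hz' : ‖z‖ = R := by simpa using hz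
      simpa only [hz'] using hKb z (by rw [hz']; exact hRr)
    have h := Complex.norm_iteratedDeriv_le_of_forall_mem_sphere_norm_le n hR0 hdc hsph
    rw [norm_smul, norm_inv, Complex.norm_natCast, inv_mul_le_iff₀ (by exact_mod_cast Nat.factorial_pos n : (0 : ℝ) < n !)]
    calc ‖iteratedDeriv n f 0‖ ≤ n ! * (K * R ^ 2) / R ^ n := h
      _ = n ! * (K * R ^ 2 / R ^ n) := by ring
  -- let `R ↑ r`
  have hcont : Tendsto (fun R : ℝ => K * R ^ 2 / R ^ n) (𝓝[<] r) (𝓝 (K * r ^ 2 / r ^ n)) := by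
    have h1 : ContinuousAt (fun R : ℝ => K * R ^ 2 / R ^ n) r :=
      ((continuousAt_const.mul (continuousAt_id.pow 2)).div (continuousAt_id.pow n) (pow_ne_zero n hr.ne'))
    exact h1.tendsto.mono_left nhdsWithin_le_nhds
  refine ge_of_tendsto hcont ?_
  have hev : ∀ᶠ R in 𝓝[<] r, 0 < R ∧ R < r :=
    ((lt_mem_nhds hr).filter_mono nhdsWithin_le_nhds).and (eventually_nhdsWithin_of_forall fun R hR => hR)
  exact hev.mono fun R hR' => hR R hR'.1 hR'.2

/-- ★★ **THE TAYLOR TERMS OF THE SLICE ARE THE DIAGONALS OF THE DIFFERENTIALS**: `Φ` of class `C^ω` on an open `U ∋ 0` ⇒ `f⁽ⁿ⁾(0) = DⁿΦ(0)(A, …, A)` (every `A`, `n`) — the slice's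
power series is `Φ`'s composed with `τ ↦ τ•A`, both sides are `n!` times the `n`-th coefficients; so print's `D^{(n)}(A′) = (n!)⁻¹DⁿD(0)(A′)ⁿ`. [cite: Balaban1985Variational, (56) p.286] -/
theorem iteratedDeriv_slice_eq_iteratedFDeriv {Φ : X → Y} {U : Set X} (hU : IsOpen U) (h0 : (0 : X) ∈ U)
    (hω : ContDiffOn ℂ ω Φ U) (A : X) (n : ℕ) :
    iteratedDeriv n (fun τ : ℂ => Φ (τ • A)) 0 = iteratedFDeriv ℂ n Φ 0 (fun _ => A) := by
  have han : AnalyticAt ℂ Φ 0 := (hω.contDiffAt (hU.mem_nhds h0)).analyticAt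
  obtain ⟨q, ρ, hq⟩ := han
  set L : ℂ →L[ℂ] X := (ContinuousLinearMap.id ℂ ℂ).smulRight A with hL
  have hLapp : ∀ τ : ℂ, L τ = τ • A := fun τ => by simp [hL]
  have hq0 : HasFPowerSeriesOnBall Φ q (L 0) ρ := by rw [hLapp, zero_smul]; exact hq
  have hcomp := hq0.compContinuousLinearMap (u := L)
  have h1 := hcomp.factorial_smul 1 n
  have h2 := hq.factorial_smul A n
  have hfun : (Φ ∘ ⇑L) = fun τ : ℂ => Φ (τ • A) := by funext τ; simp [hLapp]
  rw [hfun] at h1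
  rw [iteratedDeriv_eq_iteratedFDeriv, ← h1, ← h2]
  congr 1
  rw [FormalMultilinearSeries.compContinuousLinearMap_apply]
  congr 1
  funext i
  simp only [Function.comp_apply, hLapp, one_smul]

omit [NormedSpace ℂ Y] [CompleteSpace Y] in
/-- The tail of a series dominated by a geometric one: `HasSum a x`, `‖aₙ‖ ≤ M·qⁿ` (`0 ≤ q < 1`) ⇒ `‖x − Σ_{n<N} aₙ‖ ≤ M·qᴺ·(1 − q)⁻¹` for every `N`. [folklore] -/
theorem norm_sub_partialSum_le_of_geometric {a : ℕ → Y} {x : Y} (ha : HasSum a x) {M q : ℝ} (hq0 : 0 ≤ q) (hq1 : q < 1)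
    (hb : ∀ n, ‖a n‖ ≤ M * q ^ n) (N : ℕ) :
    ‖x - ∑ n ∈ Finset.range N, a n‖ ≤ M * q ^ N * (1 - q)⁻¹ := by
  have hs : Summable a := ha.summable
  have htail : x - ∑ n ∈ Finset.range N, a n = ∑' n, a (n + N) := by
    rw [← ha.tsum_eq, ← hs.sum_add_tsum_nat_add N, add_sub_cancel_left]
  rw [htail]
  have hgeo : HasSum (fun n : ℕ => M * q ^ N * q ^ n) (M * q ^ N * (1 - q)⁻¹) :=
    (hasSum_geometric_of_lt_one hq0 hq1).mul_left (M * q ^ N)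
  have hbd : ∀ n, ‖a (n + N)‖ ≤ M * q ^ N * q ^ n := fun n => by
    have h := hb (n + N)
    rw [pow_add] at h
    linarith [h]
  have hsum' : Summable fun n : ℕ => ‖a (n + N)‖ :=
    .of_nonneg_of_le (fun n => norm_nonneg _) hbd hgeo.summable
  calc ‖∑' n, a (n + N)‖ ≤ ∑' n, ‖a (n + N)‖ := norm_tsum_le_tsum_norm hsum'
    _ ≤ ∑' n : ℕ, M * q ^ N * q ^ n := hsum'.tsum_le_tsum hbd hgeo.summable
    _ = M * q ^ N * (1 - q)⁻¹ := hgeo.tsum_eq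

end Slice

/-! ## §2 (56) at NODE 00's record -/

/-- ★★★★ **[15] (56) — «D(A′) = Σ_{n=2}^∞ D^{(n)}(A′)» — AS A CONVERGENT SERIES FOR THE TRUE MULTI-LEVEL CHART AT NODE 00's RECORD, EVERY HOMOGENEOUS TERM NAMED, IDENTIFIED AND
SIZED.**  `N07ChartD2EqC2.exists_chartD2_eq_C2_T4` RE-EXPORTED VERBATIM (thresholds, constants, binders, the SAME `(H, Dfun)` with everything of generations 3–6) — AND, with print's
`D^{(n)}(A′)` written `(n!)⁻¹ • iteratedDeriv n (τ ↦ Dfun(τ•A′)) 0`: **(56) `HasSum (n ↦ D^{(n)}(A′)) (Dfun A′)`** (weighted size `≤ σ`, `0 < σ < ε`); **`iteratedDeriv n (τ ↦ Dfun(τ•A′)) 0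
= iteratedFDeriv ℂ n Dfun 0 (A′, …, A′)`** (every `A′`, `n`); **orders `0`, `1` vanish** ((55)); **order two is `½·Q₂(A′)(A′)`** (`= C^{(2)}(A′)`, `Q₂ = D²chartLog(0)`); **`D^{(n)}(s•A′) =
sⁿ•D^{(n)}(A′)`** («homogeneous polynomials of nth order»); **`‖D^{(n)}(A′)(j,c)‖ ≤ 4C₂ε²(σ∕ε)ⁿ`** (size `≤ σ`, any `σ > 0`, every `n`); **`‖(Dfun A′ − Σ_{n<N} D^{(n)}(A′))(j,c)‖ ≤
4C₂ε²(σ∕ε)ᴺ(1 − σ∕ε)⁻¹`** (`0 < σ < ε`, every `N`).  §1 on the slices `τ ↦ Dfun(τ•A′)`, `|τ| < ε∕σ`, of the record package, (55) read as `‖Dfun(τ•A′)‖ ≤ 4C₂σ²|τ|²`.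
[cite: Balaban1985Variational, (47)-(49) p.285, (54)-(56) p.286, Prop. 3 p.289, (78)/(80) p.290; Balaban1985Averaging, (136)-(137) p.39] -/
theorem exists_chartD56_series_T4 {ι : Type*} [Fintype ι] [DecidableEq ι] [Nonempty ι] (F : T4Family) :
    ∃ (Mh₀ R₀ : ℕ) (CK δ₀ B₃ : ℝ), 0 ≤ CK ∧ 0 < δ₀ ∧ 0 < B₃ ∧
    ∀ (n K : ℕ) (_ : 1 ≤ K - n) (_ : K - n + 1 ≤ F.m + K) {Mh R a' : ℕ} (_ : Mh = F.L ^ a') (_ : Mh₀ ≤ Mh) (_ : R₀ ≤ R) (_ : 2 * F.L ≤ R)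
      (_ : a' + 3 ≤ F.m + n) (D : Domains (F.P K)) (_ : D.k = K - n) (_ : Adm22 D R (F.L * Mh))
      (w : ℕ → PBond (F.P K) 0 → ℝ) (_ : IsLevWeight (F.P K) (K - n) D w) {ε : ℝ} (_ : 0 < ε)
      (_ : 18 * (960 * ((((F.P K).d + 2) * (F.P K).L : ℕ) : ℝ) * ((F.P K).L : ℝ) / (12800 * ((((F.P K).d + 2) * (F.P K).L : ℕ) : ℝ) ^ 2 * ((F.P K).L : ℝ))⁻¹) *
        (CK * B₃ * (1 + 2 * (((F.P K).d + 2) * (F.P K).L : ℕ)) * (1 + 2 * (((F.P K).d + 2) * (F.P K).L : ℕ) * (1 + (F.P K).L))) * ε ≤ 1)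
      (_ : 64 * ε ≤ (12800 * ((((F.P K).d + 2) * (F.P K).L : ℕ) : ℝ) ^ 2 * ((F.P K).L : ℝ))⁻¹),
      let η : ℝ := (((F.P K).L : ℝ)⁻¹) ^ (K - n)
      let Rs : ℝ := (12800 * ((((F.P K).d + 2) * (F.P K).L : ℕ) : ℝ) ^ 2 * ((F.P K).L : ℝ))⁻¹
      let C₂ : ℝ := 960 * ((((F.P K).d + 2) * (F.P K).L : ℕ) : ℝ) * ((F.P K).L : ℝ) / Rs
      let C₃ : ℝ := 3840 * ((((F.P K).d + 2) * (F.P K).L : ℕ) : ℝ) * ((F.P K).L : ℝ) / Rs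
      let Qlin := (fderiv ℂ (chartLog η D : (PBond (F.P K) 0 → Matrix ι ι ℂ) → BondIdx D → Matrix ι ι ℂ) 0)
      let Q₂ := (fderiv ℂ (fderiv ℂ (chartLog η D : (PBond (F.P K) 0 → Matrix ι ι ℂ) → BondIdx D → Matrix ι ι ℂ)) 0)
      ∃ (H : (BondIdx D → Matrix ι ι ℂ) →ₗ[ℂ] (PBond (F.P K) 0 → Matrix ι ι ℂ)) (Dfun : (PBond (F.P K) 0 → Matrix ι ι ℂ) → (BondIdx D → Matrix ι ι ℂ)),
        (∀ X, Qlin (H X) = X) ∧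
        (∀ (X : BondIdx D → Matrix ι ι ℂ) (t : ℝ), 0 ≤ t → (∀ i, ‖X i‖ ≤ t) → ∀ b,
          w 1 b * ‖H X b‖ ≤ CK * B₃ * (1 + 2 * (((F.P K).d + 2) * (F.P K).L : ℕ)) * (1 + 2 * (((F.P K).d + 2) * (F.P K).L : ℕ) * (1 + (F.P K).L)) * t) ∧
        ContDiffOn ℂ ω Dfun {A' : PBond (F.P K) 0 → Matrix ι ι ℂ | ∀ b, w 1 b * ‖A' b‖ < ε} ∧
        DifferentiableOn ℂ (fderiv ℂ Dfun) {A' : PBond (F.P K) 0 → Matrix ι ι ℂ | ∀ b, w 1 b * ‖A' b‖ < ε} ∧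
        fderiv ℂ Dfun 0 = 0 ∧
        (∀ A' : PBond (F.P K) 0 → Matrix ι ι ℂ, (∀ b, w 1 b * ‖A' b‖ < ε) →
          (∀ (ρ : ℝ), 0 ≤ ρ → (∀ b, w 1 b * ‖A' b‖ ≤ ρ) → ∀ i, ‖Dfun A' i‖ ≤ 4 * C₂ * ρ ^ 2) ∧
          chartLog η D (A' - H (Dfun A')) - Qlin (A' - H (Dfun A')) = Dfun A' ∧
          chartLog η D (A' - H (Dfun A')) = Qlin A' ∧
          HasFDerivAt Dfun (fderiv ℂ Dfun A') A' ∧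
          (∀ (W : PBond (F.P K) 0 → Matrix ι ι ℂ) (t : ℝ), 0 ≤ t → (∀ b, w 1 b * ‖W b‖ ≤ t) → ∀ i, ‖fderiv ℂ Dfun A' W i‖ ≤ 4 * C₃ * ε * t) ∧
          ∀ (b : PBond (F.P K) 0) (a : Matrix ι ι ℂ) (δ : ℝ), 0 ≤ δ → δ ≤ δ₀ / 2 →
            4 * C₃ * Real.exp (δ * 3) *
                (CK * B₃ * (1 + 2 * (((F.P K).d + 2) * (F.P K).L : ℕ) * Real.exp (δ * 4)) *
                  (1 + 2 * (((F.P K).d + 2) * (F.P K).L : ℕ) * (1 + (F.P K).L) * Real.exp (δ * 1))) * ε ≤ 1 →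
            ∀ i, ‖fderiv ℂ Dfun A' (Pi.single b a) i‖ ≤ 4 * C₃ * ε * Real.exp (δ * 2) * (w 1 b * ‖a‖) * Real.exp (-(δ * distBI D b i))) ∧
        (∀ σ : ℝ, 0 < σ → ∀ A' : PBond (F.P K) 0 → Matrix ι ι ℂ, (∀ b, w 1 b * ‖A' b‖ ≤ σ) →
          ∀ (W : PBond (F.P K) 0 → Matrix ι ι ℂ) (t : ℝ), 0 ≤ t → (∀ b, w 1 b * ‖W b‖ ≤ t) → ∀ i,
            ‖(fderiv ℂ (fderiv ℂ Dfun) 0 A') W i‖ ≤ 4 * C₃ * σ * t) ∧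
        (∀ σ : ℝ, 0 < σ → ∀ A' : PBond (F.P K) 0 → Matrix ι ι ℂ, (∀ b, w 1 b * ‖A' b‖ ≤ σ) →
          ∀ (b : PBond (F.P K) 0) (a : Matrix ι ι ℂ) (δ : ℝ), 0 ≤ δ → δ ≤ δ₀ / 2 →
            4 * C₃ * Real.exp (δ * 3) *
                (CK * B₃ * (1 + 2 * (((F.P K).d + 2) * (F.P K).L : ℕ) * Real.exp (δ * 4)) *
                  (1 + 2 * (((F.P K).d + 2) * (F.P K).L : ℕ) * (1 + (F.P K).L) * Real.exp (δ * 1))) * ε ≤ 1 →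
            ∀ i, ‖(fderiv ℂ (fderiv ℂ Dfun) 0 A') (Pi.single b a) i‖ ≤
              4 * C₃ * σ * Real.exp (δ * 2) * (w 1 b * ‖a‖) * Real.exp (-(δ * distBI D b i))) ∧
        (∀ σ : ℝ, 0 < σ → σ < ε → ∀ A' : PBond (F.P K) 0 → Matrix ι ι ℂ, (∀ b, w 1 b * ‖A' b‖ ≤ σ) →
          ∀ (W : PBond (F.P K) 0 → Matrix ι ι ℂ) (t : ℝ), 0 ≤ t → (∀ b, w 1 b * ‖W b‖ ≤ t) → ∀ i,
            ‖(fderiv ℂ Dfun A' - fderiv ℂ (fderiv ℂ Dfun) 0 A') W i‖ ≤ 8 * C₃ * (σ ^ 2 / ε) * t) ∧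
        (∀ σ : ℝ, 0 < σ → σ < ε → ∀ A' : PBond (F.P K) 0 → Matrix ι ι ℂ, (∀ b, w 1 b * ‖A' b‖ ≤ σ) →
          ∀ (b : PBond (F.P K) 0) (a : Matrix ι ι ℂ) (δ : ℝ), 0 ≤ δ → δ ≤ δ₀ / 2 →
            4 * C₃ * Real.exp (δ * 3) *
                (CK * B₃ * (1 + 2 * (((F.P K).d + 2) * (F.P K).L : ℕ) * Real.exp (δ * 4)) *
                  (1 + 2 * (((F.P K).d + 2) * (F.P K).L : ℕ) * (1 + (F.P K).L) * Real.exp (δ * 1))) * ε ≤ 1 →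
            ∀ i, ‖(fderiv ℂ Dfun A' - fderiv ℂ (fderiv ℂ Dfun) 0 A') (Pi.single b a) i‖ ≤
              8 * C₃ * Real.exp (δ * 2) * (σ ^ 2 / ε) * (w 1 b * ‖a‖) * Real.exp (-(δ * distBI D b i))) ∧
        (∀ σ : ℝ, 0 < σ → ∀ A' : PBond (F.P K) 0 → Matrix ι ι ℂ, (∀ b, w 1 b * ‖A' b‖ ≤ σ) → ∀ i,
            ‖(2 : ℂ)⁻¹ • ((fderiv ℂ (fderiv ℂ Dfun) 0 A') A') i‖ ≤ 4 * C₂ * σ ^ 2) ∧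
        (∀ σ : ℝ, 0 < σ → σ < ε → ∀ A' : PBond (F.P K) 0 → Matrix ι ι ℂ, (∀ b, w 1 b * ‖A' b‖ ≤ σ) → ∀ i,
            ‖Dfun A' i - (2 : ℂ)⁻¹ • ((fderiv ℂ (fderiv ℂ Dfun) 0 A') A') i‖ ≤ 8 * C₂ * (σ ^ 3 / ε)) ∧
        fderiv ℂ (fderiv ℂ Dfun) 0 = Q₂ ∧
        (∀ A B : PBond (F.P K) 0 → Matrix ι ι ℂ, (fderiv ℂ (fderiv ℂ Dfun) 0 A) B = (fderiv ℂ (fderiv ℂ Dfun) 0 B) A) ∧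
        (∀ A B : PBond (F.P K) 0 → Matrix ι ι ℂ, (Q₂ A) B = (Q₂ B) A) ∧
        (∀ A' : PBond (F.P K) 0 → Matrix ι ι ℂ, (2 : ℂ)⁻¹ • (fderiv ℂ (fderiv ℂ Dfun) 0 A') A' = (2 : ℂ)⁻¹ • (Q₂ A') A') ∧
        (∀ A' : PBond (F.P K) 0 → Matrix ι ι ℂ,
          HasFDerivAt (fun A : PBond (F.P K) 0 → Matrix ι ι ℂ => (2 : ℂ)⁻¹ • (fderiv ℂ (fderiv ℂ Dfun) 0 A) A) (fderiv ℂ (fderiv ℂ Dfun) 0 A') A') ∧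
        (∀ A' : PBond (F.P K) 0 → Matrix ι ι ℂ,
          HasFDerivAt (fun A : PBond (F.P K) 0 → Matrix ι ι ℂ => (2 : ℂ)⁻¹ • (Q₂ A) A) (fderiv ℂ (fderiv ℂ Dfun) 0 A') A') ∧
        (∀ A' : PBond (F.P K) 0 → Matrix ι ι ℂ, (∀ b, w 1 b * ‖A' b‖ < ε) →
          HasFDerivAt (fun A : PBond (F.P K) 0 → Matrix ι ι ℂ => Dfun A - (2 : ℂ)⁻¹ • (Q₂ A) A) (fderiv ℂ Dfun A' - Q₂ A') A') ∧
        (∀ σ : ℝ, 0 < σ → ∀ A' : PBond (F.P K) 0 → Matrix ι ι ℂ, (∀ b, w 1 b * ‖A' b‖ ≤ σ) → ∀ i,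
            ‖(2 : ℂ)⁻¹ • ((Q₂ A') A') i‖ ≤ 4 * C₂ * σ ^ 2) ∧
        (∀ σ : ℝ, 0 < σ → σ < ε → ∀ A' : PBond (F.P K) 0 → Matrix ι ι ℂ, (∀ b, w 1 b * ‖A' b‖ ≤ σ) → ∀ i,
            ‖Dfun A' i - (2 : ℂ)⁻¹ • ((Q₂ A') A') i‖ ≤ 8 * C₂ * (σ ^ 3 / ε)) ∧
        (∀ σ : ℝ, 0 < σ → ∀ A' : PBond (F.P K) 0 → Matrix ι ι ℂ, (∀ b, w 1 b * ‖A' b‖ ≤ σ) →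
          ∀ (W : PBond (F.P K) 0 → Matrix ι ι ℂ) (t : ℝ), 0 ≤ t → (∀ b, w 1 b * ‖W b‖ ≤ t) → ∀ i,
            ‖(Q₂ A') W i‖ ≤ 4 * C₃ * σ * t) ∧
        (∀ σ : ℝ, 0 < σ → ∀ A' : PBond (F.P K) 0 → Matrix ι ι ℂ, (∀ b, w 1 b * ‖A' b‖ ≤ σ) →
          ∀ (b : PBond (F.P K) 0) (a : Matrix ι ι ℂ) (δ : ℝ), 0 ≤ δ → δ ≤ δ₀ / 2 →
            4 * C₃ * Real.exp (δ * 3) *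
                (CK * B₃ * (1 + 2 * (((F.P K).d + 2) * (F.P K).L : ℕ) * Real.exp (δ * 4)) *
                  (1 + 2 * (((F.P K).d + 2) * (F.P K).L : ℕ) * (1 + (F.P K).L) * Real.exp (δ * 1))) * ε ≤ 1 →
            ∀ i, ‖(Q₂ A') (Pi.single b a) i‖ ≤
              4 * C₃ * σ * Real.exp (δ * 2) * (w 1 b * ‖a‖) * Real.exp (-(δ * distBI D b i))) ∧
        (∀ σ : ℝ, 0 < σ → σ < ε → ∀ A' : PBond (F.P K) 0 → Matrix ι ι ℂ, (∀ b, w 1 b * ‖A' b‖ ≤ σ) →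
          ∀ (W : PBond (F.P K) 0 → Matrix ι ι ℂ) (t : ℝ), 0 ≤ t → (∀ b, w 1 b * ‖W b‖ ≤ t) → ∀ i,
            ‖(fderiv ℂ Dfun A' - Q₂ A') W i‖ ≤ 8 * C₃ * (σ ^ 2 / ε) * t) ∧
        (∀ σ : ℝ, 0 < σ → σ < ε → ∀ A' : PBond (F.P K) 0 → Matrix ι ι ℂ, (∀ b, w 1 b * ‖A' b‖ ≤ σ) →
          ∀ (b : PBond (F.P K) 0) (a : Matrix ι ι ℂ) (δ : ℝ), 0 ≤ δ → δ ≤ δ₀ / 2 →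
            4 * C₃ * Real.exp (δ * 3) *
                (CK * B₃ * (1 + 2 * (((F.P K).d + 2) * (F.P K).L : ℕ) * Real.exp (δ * 4)) *
                  (1 + 2 * (((F.P K).d + 2) * (F.P K).L : ℕ) * (1 + (F.P K).L) * Real.exp (δ * 1))) * ε ≤ 1 →
            ∀ i, ‖(fderiv ℂ Dfun A' - Q₂ A') (Pi.single b a) i‖ ≤
              8 * C₃ * Real.exp (δ * 2) * (σ ^ 2 / ε) * (w 1 b * ‖a‖) * Real.exp (-(δ * distBI D b i))) ∧
        (∀ σ : ℝ, 0 < σ → σ < ε → ∀ A' : PBond (F.P K) 0 → Matrix ι ι ℂ, (∀ b, w 1 b * ‖A' b‖ ≤ σ) →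
          HasSum (fun n : ℕ => (n ! : ℂ)⁻¹ • iteratedDeriv n (fun τ : ℂ => Dfun (τ • A')) 0) (Dfun A')) ∧
        (∀ (A' : PBond (F.P K) 0 → Matrix ι ι ℂ) (n : ℕ),
          iteratedDeriv n (fun τ : ℂ => Dfun (τ • A')) 0 = iteratedFDeriv ℂ n Dfun 0 (fun _ => A')) ∧
        (∀ A' : PBond (F.P K) 0 → Matrix ι ι ℂ, iteratedDeriv 0 (fun τ : ℂ => Dfun (τ • A')) 0 = 0) ∧
        (∀ A' : PBond (F.P K) 0 → Matrix ι ι ℂ, iteratedDeriv 1 (fun τ : ℂ => Dfun (τ • A')) 0 = 0) ∧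
        (∀ A' : PBond (F.P K) 0 → Matrix ι ι ℂ,
          ((2 : ℕ) ! : ℂ)⁻¹ • iteratedDeriv 2 (fun τ : ℂ => Dfun (τ • A')) 0 = (2 : ℂ)⁻¹ • (Q₂ A') A') ∧
        (∀ (A' : PBond (F.P K) 0 → Matrix ι ι ℂ) (s : ℂ) (n : ℕ),
          iteratedDeriv n (fun τ : ℂ => Dfun (τ • (s • A'))) 0 = s ^ n • iteratedDeriv n (fun τ : ℂ => Dfun (τ • A')) 0) ∧
        (∀ σ : ℝ, 0 < σ → ∀ A' : PBond (F.P K) 0 → Matrix ι ι ℂ, (∀ b, w 1 b * ‖A' b‖ ≤ σ) → ∀ (n : ℕ) (i : BondIdx D),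
          ‖((n ! : ℂ)⁻¹ • iteratedDeriv n (fun τ : ℂ => Dfun (τ • A')) 0) i‖ ≤ 4 * C₂ * ε ^ 2 * (σ / ε) ^ n) ∧
        (∀ σ : ℝ, 0 < σ → σ < ε → ∀ A' : PBond (F.P K) 0 → Matrix ι ι ℂ, (∀ b, w 1 b * ‖A' b‖ ≤ σ) → ∀ (N : ℕ) (i : BondIdx D),
          ‖Dfun A' i - (∑ n ∈ Finset.range N, (n ! : ℂ)⁻¹ • iteratedDeriv n (fun τ : ℂ => Dfun (τ • A')) 0) i‖ ≤
            4 * C₂ * ε ^ 2 * (σ / ε) ^ N * (1 - σ / ε)⁻¹) := by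
  classical
  obtain ⟨Mh₀, R₀, CK, δ₀, B₃, hCK, hδ₀, hB₃, hmain⟩ := exists_chartD2_eq_C2_T4 (ι := ι) F
  refine ⟨Mh₀, R₀, CK, δ₀, B₃, hCK, hδ₀, hB₃, ?_⟩
  intro n K hk1 hk' Mh R a' hMha hMh hR h2L hsize D hDk hAdm w hw ε hε h18 h2 η Rs C₂ C₃ Qlin Q₂
  obtain ⟨H, Dfun, hHinv, hsup, hω, hfd, h0, hpt, hlinN, hlinK, h2N, h2K, hD2, hD3, h56, hsymD, hsymC, h56₂, hderD, hderC, hderD3,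
    hC2N, hC3N, hQlinN, hQlinK, hQ2N, hQ2K⟩ :=
    hmain n K hk1 hk' hMha hMh hR h2L hsize D hDk hAdm w hw hε h18 h2
  have hC₂ : 0 ≤ C₂ := by
    show 0 ≤ 960 * ((((F.P K).d + 2) * (F.P K).L : ℕ) : ℝ) * ((F.P K).L : ℝ) / Rs; positivity
  have hU : IsOpen {A' : PBond (F.P K) 0 → Matrix ι ι ℂ | ∀ b, w 1 b * ‖A' b‖ < ε} := isOpen_weightedBall w ε
  have h0U : (0 : PBond (F.P K) 0 → Matrix ι ι ℂ) ∈ {A' : PBond (F.P K) 0 → Matrix ι ι ℂ | ∀ b, w 1 b * ‖A' b‖ < ε} := fun b => by simpa using hε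
  have hdiff : DifferentiableOn ℂ Dfun {A' : PBond (F.P K) 0 → Matrix ι ι ℂ | ∀ b, w 1 b * ‖A' b‖ < ε} := hω.differentiableOn (by simp)
  have hΦ0 : Dfun 0 = 0 := by
    funext i
    have h := (hpt 0 h0U).1 0 le_rfl (fun b => by simp) i
    rw [zero_pow two_ne_zero, mul_zero] at h
    exact norm_le_zero_iff.mp h
  -- the complex line through a point of weighted size `≤ σ` stays in the ball for `|τ| < ε∕σ`, with size `≤ |τ|σ`
  have hsizeτ : ∀ (σ : ℝ) (A' : PBond (F.P K) 0 → Matrix ι ι ℂ), (∀ b, w 1 b * ‖A' b‖ ≤ σ) →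
      ∀ (τ : ℂ) (b : PBond (F.P K) 0), w 1 b * ‖(τ • A') b‖ ≤ ‖τ‖ * σ := fun σ A' hA' τ b => by
    rw [Pi.smul_apply, norm_smul, mul_left_comm]; exact mul_le_mul_of_nonneg_left (hA' b) (norm_nonneg τ)
  have hline : ∀ (σ : ℝ), 0 < σ → ∀ A' : PBond (F.P K) 0 → Matrix ι ι ℂ, (∀ b, w 1 b * ‖A' b‖ ≤ σ) →
      ∀ τ : ℂ, ‖τ‖ < ε / σ → (τ • A') ∈ {A' : PBond (F.P K) 0 → Matrix ι ι ℂ | ∀ b, w 1 b * ‖A' b‖ < ε} :=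
    fun σ hσ A' hA' τ hτ b => (hsizeτ σ A' hA' τ b).trans_lt (by rwa [lt_div_iff₀ hσ] at hτ)
  -- (55) read on the slice, whole vector: `‖Dfun(τ•A′)‖ ≤ 4C₂σ²·|τ|²`
  have h55τ : ∀ (σ : ℝ), 0 < σ → ∀ A' : PBond (F.P K) 0 → Matrix ι ι ℂ, (∀ b, w 1 b * ‖A' b‖ ≤ σ) → ∀ (τ : ℂ), ‖τ‖ < ε / σ →
      ‖Dfun (τ • A')‖ ≤ 4 * C₂ * σ ^ 2 * ‖τ‖ ^ 2 := by
    intro σ hσ A' hA' τ hτ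
    refine (pi_norm_le_iff_of_nonneg (by positivity)).mpr fun i => ?_
    have h := (hpt (τ • A') (hline σ hσ A' hA' τ hτ)).1 (‖τ‖ * σ) (by positivity) (hsizeτ σ A' hA' τ) i
    rw [← show 4 * C₂ * (‖τ‖ * σ) ^ 2 = 4 * C₂ * σ ^ 2 * ‖τ‖ ^ 2 by ring]
    exact h
  have hdiag : ∀ (A' : PBond (F.P K) 0 → Matrix ι ι ℂ) (n : ℕ),
      iteratedDeriv n (fun τ : ℂ => Dfun (τ • A')) 0 = iteratedFDeriv ℂ n Dfun 0 (fun _ => A') :=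
    fun A' n => iteratedDeriv_slice_eq_iteratedFDeriv hU h0U hω A' n
  -- Cauchy, whole vector: `‖D^{(n)}(A′)‖ ≤ 4C₂ε²(σ∕ε)ⁿ`
  have hcauchy : ∀ σ : ℝ, 0 < σ → ∀ A' : PBond (F.P K) 0 → Matrix ι ι ℂ, (∀ b, w 1 b * ‖A' b‖ ≤ σ) → ∀ n : ℕ,
      ‖(n ! : ℂ)⁻¹ • iteratedDeriv n (fun τ : ℂ => Dfun (τ • A')) 0‖ ≤ 4 * C₂ * ε ^ 2 * (σ / ε) ^ n := by
    intro σ hσ A' hA' n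
    have hr : 0 < ε / σ := div_pos hε hσ
    have h := norm_taylor_slice_le hdiff A' hr (hline σ hσ A' hA') (h55τ σ hσ A' hA') n
    have hσne : σ ≠ 0 := hσ.ne'
    have h1 : σ ^ 2 * (ε / σ) ^ 2 = ε ^ 2 := by rw [div_pow]; field_simp
    have h2 : ((ε / σ) ^ n)⁻¹ = (σ / ε) ^ n := by rw [← inv_pow, inv_div]
    have heq : 4 * C₂ * σ ^ 2 * (ε / σ) ^ 2 / (ε / σ) ^ n = 4 * C₂ * ε ^ 2 * (σ / ε) ^ n := by
      calc 4 * C₂ * σ ^ 2 * (ε / σ) ^ 2 / (ε / σ) ^ n = 4 * C₂ * (σ ^ 2 * (ε / σ) ^ 2) * ((ε / σ) ^ n)⁻¹ := by ring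
        _ = 4 * C₂ * ε ^ 2 * (σ / ε) ^ n := by rw [h1, h2]
    rw [← heq]; exact h
  refine ⟨H, Dfun, hHinv, hsup, hω, hfd, h0, hpt, hlinN, hlinK, h2N, h2K, hD2, hD3, h56, hsymD, hsymC, h56₂, hderD, hderC, hderD3,
    hC2N, hC3N, hQlinN, hQlinK, hQ2N, hQ2K, ?_, hdiag, ?_, ?_, ?_, ?_, ?_, ?_⟩
  · -- (56): the Taylor series of the slice at `τ = 1 < ε∕σ`
    intro σ hσ hσε A' hA'
    have hr : 1 < ε / σ := by rwa [lt_div_iff₀ hσ, one_mul]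
    have h := hasSum_taylor_slice hdiff A' (hline σ hσ A' hA') (τ := 1) (by simpa using hr)
    simpa only [one_pow, one_smul] using h
  · -- order `0`: `Dfun 0 = 0`
    intro A'
    rw [iteratedDeriv_zero, zero_smul, hΦ0]
  · -- order `1`: `fderiv ℂ Dfun 0 = 0`
    intro A'
    rw [hdiag A' 1, iteratedFDeriv_one_apply, h0]
    rfl
  · -- order `2`: `½D²Dfun(0)(A′, A′) = ½Q₂(A′)(A′)`
    intro A'
    rw [hdiag A' 2, iteratedFDeriv_two_apply, h56, Nat.factorial_two, Nat.cast_ofNat]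
  · -- homogeneity
    intro A' s n
    exact taylor_slice_smul hU h0U hdiff A' s n
  · -- Cauchy, per index
    intro σ hσ A' hA' n i
    exact (norm_le_pi_norm _ i).trans (hcauchy σ hσ A' hA' n)
  · -- the tail, per index
    intro σ hσ hσε A' hA' N i
    have hr : 1 < ε / σ := by rwa [lt_div_iff₀ hσ, one_mul]
    have hsum := hasSum_taylor_slice hdiff A' (hline σ hσ A' hA') (τ := 1) (by simpa using hr)
    simp only [one_pow, one_smul] at hsum
    have hq0 : 0 ≤ σ / ε := by positivity
    have hq1 : σ / ε < 1 := (div_lt_one hε).mpr hσε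
    have h := norm_sub_partialSum_le_of_geometric hsum hq0 hq1 (hcauchy σ hσ A' hA') N
    refine le_trans ?_ h
    exact norm_le_pi_norm (Dfun A' - ∑ n ∈ Finset.range N, (n ! : ℂ)⁻¹ • iteratedDeriv n (fun τ : ℂ => Dfun (τ • A')) 0) i

end Summit.QuantumFields.YangMills.BalabanUVNodes.N07ChartD56Series

end
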